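import Literature.Barriers.AtomisticToContinuum.AnticontinuumLocalizationThm1Transplant
import Literature.Barriers.AtomisticToContinuum.AnticontinuumLocalizationProductStructure
import Mathlib.MeasureTheory.Integral.Pi
import Mathlib.MeasureTheory.Integral.Prod
import HarnessLib

/-!
# De Roeck–Huveneers 2015, Theorem 1: the Gibbs-state inputs of the window reduction

`Literature/Barriers/AtomisticToContinuum/` — second half of the toolbox for
"window solutions ⟹ `DeRoeckHuveneers2015_thm1`" (Theorem 1 of De Roeck–Huveneers,
CPAM 68 (2015), arXiv:1305.5127). Measure-theoretic facts about the Gibbs state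
`⟨·⟩_T = Z⁻¹ e^{-H/T} dq dω` of the `N`-chain (`RotorChain.gibbsMeasure`):

* `lintegral_comp_windowProj_snd` — **momentum marginals are Gaussian**: for `f ≥ 0` measurable on
  `ℝ^S`, `⟨f(ω|_S)⟩_T = ∫ f d𝒩(0,T)^{⊗S}` (product structure `gibbsMeasure_eq_prod` and the image of
  a product of i.i.d. laws under restriction to a sub-family of coordinates,
  `pi_map_comp_of_injective`);
* `integrable_sq_of_enorm_le` / `sq_bound_of_window_majorant` — an `ω|_S`-only majorant with
  Gaussian second moment `≤ B` gives `Integrable F²` and `∫ F² d⟨·⟩_T ≤ B`;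
* `integral_sq_sub_average_le` — subtracting the mean does not increase the second moment;
* `integral_bondCurrent` — `⟨J_{a,a+1}⟩_T = 0` (odd in `ω_{a+1}`, `∫ x d𝒩(0,T) = 0`);
* `integral_liouville_eq_zero` — **`⟨L_H F⟩_T = 0`** for `F ∈ C¹(Ω_N)` angle-periodic with
  `F, L_H F ∈ L¹` ("by invariance of the Gibbs state", §5.2): along THE flow `X^t`
  (`rotorFlow`, `IsFlow.stationary`) `⟨F ∘ X¹⟩ - ⟨F⟩ = 0 = ∫₀¹ ⟨(L_H F) ∘ X^s⟩ ds = ⟨L_H F⟩`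
  (FTC along the flow `IsFlow.integral_liouville`, Fubini, stationarity twice), together with the
  periodicity of `L_H F` (`isAnglePeriodic_liouville`).

All proved, theorem-only. [cite: DeRoeckHuveneers2015, §5.2 and §2.2]
-/

noncomputable section

open MeasureTheory ProbabilityTheory Function Set Filter
open scoped ENNReal NNReal ContDiff Topology

namespace Literature.Barriers.AtomisticToContinuum.HeatConduction.RotorChain

open Literature.MathematicalPhysics.KineticTheory.HeatConduction

variable {N : ℕ}

/-! ### Momentum marginals of the Gibbs state -/

/-- The image of a finite product of copies of a probability law under restriction to an
injectively indexed sub-family of coordinates is the product over the sub-family. [folklore] -/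
theorem pi_map_comp_of_injective {ι κ : Type*} [Fintype ι] [Fintype κ] (μ : Measure ℝ)
    [IsProbabilityMeasure μ] {e : κ → ι} (he : Injective e) :
    (Measure.pi fun _ : ι => μ).map (fun w k => w (e k)) = Measure.pi fun _ : κ => μ := by
  classical
  symm
  refine Measure.pi_eq fun s hs => ?_
  have hmeas : Measurable fun (w : ι → ℝ) (k : κ) => w (e k) :=
    measurable_pi_lambda _ fun k => measurable_pi_apply (e k)
  rw [Measure.map_apply hmeas (MeasurableSet.univ_pi hs)]
  have hpre : (fun (w : ι → ℝ) (k : κ) => w (e k)) ⁻¹' Set.pi univ s =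
      Set.pi univ (Function.extend e s fun _ => univ) := by
    ext w
    simp only [mem_preimage, mem_univ_pi]
    constructor
    · intro h i
      by_cases hi : ∃ k, e k = i
      · obtain ⟨k, rfl⟩ := hi
        rw [he.extend_apply]
        exact h k
      · rw [Function.extend_apply' _ _ _ hi]
        exact mem_univ _
    · intro h k
      have := h (e k)
      rwa [he.extend_apply] at this
  rw [hpre, Measure.pi_pi]
  rw [← Finset.prod_subset (Finset.subset_univ (Finset.univ.image e))]
  · rw [Finset.prod_image fun k _ k' _ h => he h]
    exact Finset.prod_congr rfl fun k _ => by rw [he.extend_apply]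
  · intro i _ hi
    have hi' : ¬ ∃ k, e k = i := fun ⟨k, hk⟩ => hi (Finset.mem_image.2 ⟨k, Finset.mem_univ _, hk⟩)
    rw [Function.extend_apply' _ _ _ hi', measure_univ]

/-- **Momentum marginals of the Gibbs state are Gaussian**: for measurable `f ≥ 0` on the momenta
of a window `S`, `⟨f(ω|_S)⟩_T = ∫ f d𝒩(0,T)^{⊗S}`. [cite: DeRoeckHuveneers2015, §5.5 proof of Lemma 4 ("the Gibbs measure factorizes with respect to the variables `ω_y`")] -/
theorem lintegral_comp_windowProj_snd {T ε γ : ℝ} (hT : 0 < T) (hε : 0 ≤ ε) (hγ : 0 ≤ γ)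
    (a : Fin N) (M : ℕ) {f : (Fin (windowSize a M) → ℝ) → ℝ≥0∞} (hf : Measurable f) :
    ∫⁻ z, f (windowProj a M z).2 ∂(gibbsMeasure N T ε γ) =
      ∫⁻ w, f w ∂(Measure.pi fun _ : Fin (windowSize a M) => gaussianReal 0 T.toNNReal) := by
  haveI := isProbabilityMeasure_configGibbs (N := N) (div_nonneg hε hT.le) hγ
  have hmeas : Measurable fun (w : Fin N → ℝ) (k : Fin (windowSize a M)) => w (windowEmb a M k) :=
    measurable_pi_lambda _ fun k => measurable_pi_apply _
  rw [gibbsMeasure_eq_prod hT hε hγ]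
  have h1 : ∫⁻ z, f (windowProj a M z).2 ∂((configGibbs N (ε / T) γ).prod
        (Measure.pi fun _ : Fin N => gaussianReal 0 T.toNNReal)) =
      ∫⁻ _q, ∫⁻ w, f (fun k => w (windowEmb a M k))
        ∂(Measure.pi fun _ : Fin N => gaussianReal 0 T.toNNReal) ∂(configGibbs N (ε / T) γ) := by
    rw [lintegral_prod]
    · rfl
    · exact (hf.comp (hmeas.comp measurable_snd)).aemeasurable
  rw [h1, lintegral_const, measure_univ, mul_one,
    ← pi_map_comp_of_injective (gaussianReal 0 T.toNNReal) (windowEmb_injective a M),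
    lintegral_map hf hmeas]

/-! ### From `ω`-majorants to `L²` bounds -/

/-- A pointwise `ℝ≥0∞` majorant with finite square-`lintegral` bound `≤ B` makes `F²` integrable
with `∫ F² ≤ B`. [folklore] -/
theorem integrable_sq_of_enorm_le {α : Type*} [MeasurableSpace α] {μ : Measure α} {F : α → ℝ}
    (hF : AEStronglyMeasurable F μ) {g : α → ℝ≥0∞} (hle : ∀ z, ‖F z‖ₑ ≤ g z) {B : ℝ} (hB : 0 ≤ B)
    (hg : ∫⁻ z, g z ^ 2 ∂μ ≤ ENNReal.ofReal B) :
    Integrable (fun z => F z ^ 2) μ ∧ ∫ z, F z ^ 2 ∂μ ≤ B := by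
  have hbound : ∫⁻ z, ‖F z ^ 2‖ₑ ∂μ ≤ ENNReal.ofReal B := by
    refine le_trans (lintegral_mono fun z => ?_) hg
    rw [enorm_pow]
    exact pow_le_pow_left' (hle z) 2
  have hint : Integrable (fun z => F z ^ 2) μ :=
    ⟨hF.pow 2, lt_of_le_of_lt hbound ENNReal.ofReal_lt_top⟩
  refine ⟨hint, ?_⟩
  rw [integral_eq_lintegral_of_nonneg_ae (Eventually.of_forall fun z => sq_nonneg (F z)) (hF.pow 2)]
  have : ∫⁻ z, ENNReal.ofReal (F z ^ 2) ∂μ ≤ ENNReal.ofReal B := by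
    refine le_trans (lintegral_mono fun z => ?_) hbound
    rw [Real.enorm_eq_ofReal (sq_nonneg _)]
  exact (ENNReal.toReal_mono ENNReal.ofReal_ne_top this).trans (by rw [ENNReal.toReal_ofReal hB])

/-- **`ω|_S`-majorants give the `L²(⟨·⟩_T)` bounds**: if `|F(z)| ≤ u(ω|_S)` with
`∫ u² d𝒩(0,T)^{⊗S} ≤ B`, then `F² ∈ L¹(⟨·⟩_T)` and `⟨F²⟩_T ≤ B`. [cite: DeRoeckHuveneers2015, §5.6 (5.17)–(5.19)] -/
theorem sq_bound_of_window_majorant {T ε γ : ℝ} (hT : 0 < T) (hε : 0 ≤ ε) (hγ : 0 ≤ γ)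
    (a : Fin N) (M : ℕ) {F : PhaseSpace N → ℝ} (hF : AEStronglyMeasurable F (gibbsMeasure N T ε γ))
    {u : (Fin (windowSize a M) → ℝ) → ℝ≥0∞} (hu : Measurable u)
    (hle : ∀ z, ‖F z‖ₑ ≤ u (windowProj a M z).2) {B : ℝ} (hB : 0 ≤ B)
    (hbound : ∫⁻ w, u w ^ 2 ∂(Measure.pi fun _ : Fin (windowSize a M) => gaussianReal 0 T.toNNReal) ≤
      ENNReal.ofReal B) :
    Integrable (fun z => F z ^ 2) (gibbsMeasure N T ε γ) ∧ ∫ z, F z ^ 2 ∂(gibbsMeasure N T ε γ) ≤ B := by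
  refine integrable_sq_of_enorm_le hF (g := fun z => u (windowProj a M z).2) hle hB ?_
  rw [lintegral_comp_windowProj_snd hT hε hγ a M (f := fun w => u w ^ 2) (hu.pow_const 2)]
  exact hbound

/-- On a probability space, an `L²` function is integrable and subtracting its mean does not
increase the second moment: `∫ (F - ⟨F⟩)² = ∫ F² - ⟨F⟩² ≤ ∫ F²`. [folklore] -/
theorem integral_sq_sub_average_le {α : Type*} [MeasurableSpace α] {μ : Measure α}
    [IsProbabilityMeasure μ] {F : α → ℝ} (hF : AEStronglyMeasurable F μ)
    (hF2 : Integrable (fun z => F z ^ 2) μ) :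
    Integrable F μ ∧ Integrable (fun z => (F z - ∫ w, F w ∂μ) ^ 2) μ ∧
      ∫ z, (F z - ∫ w, F w ∂μ) ∂μ = 0 ∧
      ∫ z, (F z - ∫ w, F w ∂μ) ^ 2 ∂μ ≤ ∫ z, F z ^ 2 ∂μ := by
  have hL2 : MemLp F 2 μ := (memLp_two_iff_integrable_sq hF).2 hF2
  have hF1 : Integrable F μ := hL2.integrable one_le_two
  set c := ∫ w, F w ∂μ with hc
  have hL2' : MemLp (fun z => F z - c) 2 μ := hL2.sub (memLp_const c)
  have hint : Integrable (fun z => (F z - c) ^ 2) μ :=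
    (memLp_two_iff_integrable_sq (hF.sub aestronglyMeasurable_const)).1 hL2'
  refine ⟨hF1, hint, ?_, ?_⟩
  · rw [integral_sub hF1 (integrable_const c), integral_const, probReal_univ, one_smul, hc,
      sub_self]
  · have hexp : ∀ z, (F z - c) ^ 2 = F z ^ 2 - 2 * c * F z + c ^ 2 := fun z => by ring
    simp_rw [hexp]
    have hi : Integrable (fun z => F z ^ 2 - 2 * c * F z) μ := hF2.sub (hF1.const_mul (2 * c))
    rw [integral_add hi (integrable_const _), integral_sub hF2 (hF1.const_mul _),
      integral_const_mul, integral_const, probReal_univ, one_smul, ← hc]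
    nlinarith [sq_nonneg c]

/-! ### `⟨J_{a,a+1}⟩_T = 0` -/

/-- The bond current made explicit: `J_{a,a+1} = ω_{a+1} sin(q_a - q_{a+1})`, or `0` at the last
site. [cite: DeRoeckHuveneers2015, §2.4] -/
theorem bondCurrent_eq_dite (K : ℕ) (c : Fin K) (w : PhaseSpace K) :
    bondCurrent K c w =
      if h : c.val + 1 < K then w.2 ⟨c.val + 1, h⟩ * Real.sin (w.1 c - w.1 ⟨c.val + 1, h⟩) else 0 := by
  unfold bondCurrent
  by_cases h : c.val + 1 < K
  · rw [dif_pos h, Finset.sum_eq_single_of_mem (⟨c.val + 1, h⟩ : Fin K) (Finset.mem_univ _)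
      (fun y _ hy => if_neg fun e => hy (Fin.ext e))]
    simp
  · rw [dif_neg h]
    exact Finset.sum_eq_zero fun y _ => if_neg (by have := y.isLt; omega)

/-- **`⟨J_{a,a+1}⟩_T = 0`**: the current is odd in `ω_{a+1}`, the Gibbs state is a product with
centred Gaussian momenta. [cite: DeRoeckHuveneers2015, §2.2] -/
theorem integral_bondCurrent {T ε γ : ℝ} (hT : 0 < T) (hε : 0 ≤ ε) (hγ : 0 ≤ γ) (a : Fin N) :
    ∫ z, bondCurrent N a z ∂(gibbsMeasure N T ε γ) = 0 := by
  haveI := isProbabilityMeasure_configGibbs (N := N) (div_nonneg hε hT.le) hγ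
  by_cases h : a.val + 1 < N
  · set a' : Fin N := ⟨a.val + 1, h⟩
    have hJ : (fun z : PhaseSpace N => bondCurrent N a z) =
        fun z => Real.sin (z.1 a - z.1 a') * z.2 a' := by
      funext z; rw [bondCurrent_eq_dite, dif_pos h]; ring
    rw [hJ, gibbsMeasure_eq_prod hT hε hγ,
      integral_prod_mul (μ := configGibbs N (ε / T) γ)
        (ν := Measure.pi fun _ : Fin N => gaussianReal 0 T.toNNReal)
        (fun q : Fin N → ℝ => Real.sin (q a - q a')) (fun w : Fin N → ℝ => w a')]
    rw [integral_eval (μ := fun _ : Fin N => gaussianReal 0 T.toNNReal) (i := a'),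
      integral_id_gaussianReal, mul_zero]
  · have hJ : (fun z : PhaseSpace N => bondCurrent N a z) = fun _ => 0 := by
      funext z; rw [bondCurrent_eq_dite, dif_neg h]
    rw [hJ, integral_zero]

/-! ### Periodicity of `L_H F` -/

/-- The rotor Hamiltonian is a function on `Ω_N` (`2π`-periodic in every angle). [cite: DeRoeckHuveneers2015, §2.1] -/
theorem isAnglePeriodic_hamiltonian (ε γ : ℝ) : IsAnglePeriodic N (hamiltonian N ε γ) := by
  intro z x
  unfold hamiltonian siteEnergy sitePotential
  refine Finset.sum_congr rfl fun y _ => ?_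
  have hcos : ∀ (u v : Fin N), Real.cos (update z.1 x (z.1 x + 2 * Real.pi) u -
      update z.1 x (z.1 x + 2 * Real.pi) v) = Real.cos (z.1 u - z.1 v) := by
    intro u v
    by_cases hu : u = x <;> by_cases hv : v = x
    · subst hu; subst hv; simp
    · subst hu
      rw [update_self, update_of_ne hv, show z.1 u + 2 * Real.pi - z.1 v = (z.1 u - z.1 v) + 2 * Real.pi by ring,
        Real.cos_add_two_pi]
    · subst hv
      rw [update_self, update_of_ne hu,
        show z.1 u - (z.1 v + 2 * Real.pi) = (z.1 u - z.1 v) - 2 * Real.pi by ring, Real.cos_sub_two_pi]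
    · rw [update_of_ne hu, update_of_ne hv]
  have hcos1 : Real.cos (update z.1 x (z.1 x + 2 * Real.pi) y) = Real.cos (z.1 y) := by
    by_cases hy : y = x
    · subst hy; rw [update_self, Real.cos_add_two_pi]
    · rw [update_of_ne hy]
  simp only [hcos, hcos1]

/-- `∂_{q_x}` of an angle-periodic function is angle-periodic. [folklore] -/
theorem isAnglePeriodic_partialQ {F : PhaseSpace N → ℝ} (hF : IsAnglePeriodic N F) (x : Fin N) :
    IsAnglePeriodic N (partialQ x F) := by
  intro z y
  unfold partialQ
  by_cases hxy : x = y
  · subst hxy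
    simp only [update_self, update_idem]
    -- `t ↦ F(q[x ↦ t], ω)` is `2π`-periodic
    set g : ℝ → ℝ := fun t => F (update z.1 x t, z.2) with hg
    have hper : ∀ t, g (t + 2 * Real.pi) = g t := fun t => by
      have := hF (update z.1 x t, z.2) x
      simp only [update_self, update_idem] at this
      exact this
    have h2 : deriv g (z.1 x) = deriv (fun t => g (t + 2 * Real.pi)) (z.1 x) := by
      congr 1; funext t; exact (hper t).symm
    rw [h2, deriv_comp_add_const]
  · have hne : y ≠ x := fun h => hxy h.symm
    simp only [update_of_ne hxy]
    congr 1
    funext t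
    rw [update_comm hne]
    have := hF (update z.1 x t, z.2) y
    simp only [update_of_ne hne] at this
    exact this

/-- `∂_{ω_x}` of an angle-periodic function is angle-periodic. [folklore] -/
theorem isAnglePeriodic_partialP {F : PhaseSpace N → ℝ} (hF : IsAnglePeriodic N F) (x : Fin N) :
    IsAnglePeriodic N (partialP x F) := by
  intro z y
  unfold partialP
  congr 1
  funext t
  exact hF (z.1, update z.2 x t) y

/-- `L_H F` is angle-periodic for angle-periodic `F`. [folklore] -/
theorem isAnglePeriodic_liouville {F : PhaseSpace N → ℝ} (hF : IsAnglePeriodic N F) (ε γ : ℝ) :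
    IsAnglePeriodic N (liouville N ε γ F) := by
  intro z y
  unfold liouville
  refine Finset.sum_congr rfl fun x _ => ?_
  rw [isAnglePeriodic_partialP (isAnglePeriodic_hamiltonian ε γ) x z y,
    isAnglePeriodic_partialQ (isAnglePeriodic_hamiltonian ε γ) x z y,
    isAnglePeriodic_partialQ hF x z y, isAnglePeriodic_partialP hF x z y]

/-! ### Stationarity: `⟨L_H F⟩_T = 0` -/

variable {ε γ : ℝ} {Φ : ℝ → PhaseSpace N → PhaseSpace N}

/-- Stationarity of the Gibbs state for real observables: for a flow map `X^s`, a continuous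
angle-periodic integrable `f`, `f ∘ X^s` is integrable and `⟨f ∘ X^s⟩_T = ⟨f⟩_T`.
[cite: DeRoeckHuveneers2015, §5.2 ("by invariance of the Gibbs state")] -/
theorem IsFlow.integrable_comp_and_integral_eq (hΦ : IsFlow N ε γ Φ) (T : ℝ) {f : PhaseSpace N → ℝ}
    (hfc : Continuous f) (hfp : IsAnglePeriodic N f) (hfi : Integrable f (gibbsMeasure N T ε γ))
    (s : ℝ) :
    Integrable (fun z => f (Φ s z)) (gibbsMeasure N T ε γ) ∧
      ∫ z, f (Φ s z) ∂(gibbsMeasure N T ε γ) = ∫ z, f z ∂(gibbsMeasure N T ε γ) := by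
  have hstat := hΦ.stationary T
  have hcs : Continuous fun z => f (Φ s z) := hfc.comp (hΦ.continuous_at s)
  have hpos : ∫⁻ z, ENNReal.ofReal (f (Φ s z)) ∂(gibbsMeasure N T ε γ) =
      ∫⁻ z, ENNReal.ofReal (f z) ∂(gibbsMeasure N T ε γ) :=
    hstat (fun z => ENNReal.ofReal (f z)) hfc.measurable.ennreal_ofReal
      (fun z x => by simp only [hfp z x]) s
  have hneg : ∫⁻ z, ENNReal.ofReal (-f (Φ s z)) ∂(gibbsMeasure N T ε γ) =
      ∫⁻ z, ENNReal.ofReal (-f z) ∂(gibbsMeasure N T ε γ) :=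
    hstat (fun z => ENNReal.ofReal (-f z)) hfc.neg.measurable.ennreal_ofReal
      (fun z x => by simp only [hfp z x]) s
  have hnorm : ∫⁻ z, ‖f (Φ s z)‖ₑ ∂(gibbsMeasure N T ε γ) = ∫⁻ z, ‖f z‖ₑ ∂(gibbsMeasure N T ε γ) :=
    hstat (fun z => ‖f z‖ₑ) hfc.measurable.enorm (fun z x => by simp only [hfp z x]) s
  have hint : Integrable (fun z => f (Φ s z)) (gibbsMeasure N T ε γ) := by
    refine ⟨hcs.aestronglyMeasurable, ?_⟩
    unfold HasFiniteIntegral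
    rw [hnorm]
    exact hfi.2
  refine ⟨hint, ?_⟩
  rw [integral_eq_lintegral_pos_part_sub_lintegral_neg_part hint,
    integral_eq_lintegral_pos_part_sub_lintegral_neg_part hfi, hpos, hneg]

/-- **`⟨L_H F⟩_T = 0`** for `F ∈ C¹(Ω_N)` angle-periodic with `F, L_H F ∈ L¹(⟨·⟩_T)`: with THE flow
`X^t` of the chain, `0 = ⟨F ∘ X¹⟩_T - ⟨F⟩_T = ⟨∫₀¹ (L_H F)(X^s) ds⟩_T = ∫₀¹ ⟨(L_H F) ∘ X^s⟩_T ds = ⟨L_H F⟩_T`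
(stationarity, FTC along the flow, Fubini, stationarity). [cite: DeRoeckHuveneers2015, §5.2 ("`⟨L_H H_{>a}⟩_T = 0`, by invariance of the Gibbs state")] -/
theorem integral_liouville_eq_zero (T ε γ : ℝ) {F : PhaseSpace N → ℝ} (hF : ContDiff ℝ 1 F)
    (hFp : IsAnglePeriodic N F) (hFi : Integrable F (gibbsMeasure N T ε γ))
    (hLi : Integrable (liouville N ε γ F) (gibbsMeasure N T ε γ)) :
    ∫ z, liouville N ε γ F z ∂(gibbsMeasure N T ε γ) = 0 := by
  set μ := gibbsMeasure N T ε γ with hμ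
  have hΦ := isFlow_rotorFlow N ε γ
  set Φ := rotorFlow N ε γ with hΦdef
  set L := liouville N ε γ F with hL
  have hLc : Continuous L := continuous_liouville ε γ hF one_ne_zero
  have hLp : IsAnglePeriodic N L := isAnglePeriodic_liouville hFp ε γ
  -- stationarity for `F` at time `1` and for `L` at every time
  obtain ⟨hF1i, hF1⟩ := hΦ.integrable_comp_and_integral_eq T hF.continuous hFp hFi 1
  have hLs : ∀ s, Integrable (fun z => L (Φ s z)) μ ∧ ∫ z, L (Φ s z) ∂μ = ∫ z, L z ∂μ := fun s =>
    hΦ.integrable_comp_and_integral_eq T hLc hLp hLi s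
  -- the time measure on `(0, 1]`
  set ν : Measure ℝ := volume.restrict (Ioc (0 : ℝ) 1) with hν
  have hν1 : ν univ = 1 := by
    rw [hν, Measure.restrict_apply MeasurableSet.univ, univ_inter, Real.volume_Ioc]; simp
  haveI : IsFiniteMeasure ν := ⟨by rw [hν1]; exact ENNReal.one_lt_top⟩
  -- joint integrability of `(z, s) ↦ L (X^s z)` on `μ ⊗ ν`
  have hjc : Continuous fun p : PhaseSpace N × ℝ => L (Φ p.2 p.1) :=
    hLc.comp (hΦ.continuous.comp (continuous_snd.prodMk continuous_fst))
  have hG : Integrable (fun p : PhaseSpace N × ℝ => L (Φ p.2 p.1)) (μ.prod ν) := by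
    refine ⟨hjc.aestronglyMeasurable, ?_⟩
    unfold HasFiniteIntegral
    rw [lintegral_prod_symm _ hjc.measurable.enorm.aemeasurable]
    have hinner : ∀ s, ∫⁻ z, ‖L (Φ s z)‖ₑ ∂μ = ∫⁻ z, ‖L z‖ₑ ∂μ := fun s =>
      hΦ.stationary T (fun z => ‖L z‖ₑ) hLc.measurable.enorm (fun z x => by simp only [hLp z x]) s
    simp only [hinner]
    rw [lintegral_const, hν1, mul_one]
    exact hLi.2
  -- `∫ z (∫ s, L (X^s z) dν) dμ` computed in two ways
  have h1 : ∫ z, (∫ s, L (Φ s z) ∂ν) ∂μ = ∫ z, (F (Φ 1 z) - F z) ∂μ := by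
    refine integral_congr_ae (Eventually.of_forall fun z => ?_)
    simp only
    rw [hν, ← intervalIntegral.integral_of_le zero_le_one, hL, hΦ.integral_liouville hF one_ne_zero z 0 1,
      hΦ.map_zero]
  have h2 : ∫ z, (∫ s, L (Φ s z) ∂ν) ∂μ = ∫ s, (∫ z, L (Φ s z) ∂μ) ∂ν :=
    integral_integral_swap (f := fun (z : PhaseSpace N) (s : ℝ) => L (Φ s z)) hG
  have h3 : ∫ s, (∫ z, L (Φ s z) ∂μ) ∂ν = ∫ z, L z ∂μ := by
    simp only [fun s => (hLs s).2]
    rw [integral_const, measureReal_def, hν1, ENNReal.toReal_one, one_smul]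
  have h4 : ∫ z, (F (Φ 1 z) - F z) ∂μ = 0 := by
    rw [integral_sub hF1i hFi, hF1, sub_self]
  rw [← h3, ← h2, h1, h4]

end Literature.Barriers.AtomisticToContinuum.HeatConduction.RotorChain

end
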